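import Literature.NumberTheory.ComplexMultiplication.SharedImaginaryQuadraticDegenerate
import Literature.NumberTheory.ComplexMultiplication.PartialConjugationOfConjSquare
import HarnessLib

/-!
# Two Galois CM fields of degree `2p` (`p` an odd prime): a DICHOTOMY — their Galois closures meet in a totally real field
# (partial conjugations, additive rank), or in a shared imaginary quadratic field (degenerate family), according to
# `[L₀ ∩ L₁ : ℚ] ∈ {1, p}` or `= 2`

Companion of `NumberTheory/ComplexMultiplication/PartialConjugationOfRealIntersection` (partial conjugations ⟸ Galois
closures meeting in totally real fields; two slots: conjugation fixes `L_{i₀} ∩ L_{i₁}`, e.g. odd degree) and of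
`…/SharedImaginaryQuadraticDegenerate` (a shared imaginary quadratic field with non-zero signature defects ⟹ the family
is degenerate).  For two GALOIS CM fields `K_{i₀}`, `K_{i₁}` of degree `2p`, `p` an ODD PRIME (cyclic sextics `ℚ(ζ_7)`,
`ℚ(ζ_9)`, `k·C`; degree `10`, `14`, …), with different images `L₀ ≠ L₁` in `ℂ`, the degree `d = [L₀ ∩ L₁ : ℚ]` divides `2p`
and is not `2p`, so `d ∈ {1, 2, p}` (`finrank_inf_mem_of_prime`), and:

* **`forall_exists_partialConj_pair_of_prime_of_finrank_inf_ne_two`** — if `d ≠ 2` then `d` is odd, `L₀ ∩ L₁` is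
  totally real and both slots carry PARTIAL CONJUGATIONS (hence, downstream, `Hg(A₀ × A₁) = Hg(A₀) × Hg(A₁)`, `B• = D•`
  and the Hodge conjecture for all `A₀^a × A₁^b` of realisations of primitive types: `Summits/…/PrimeDegreeCMFieldPairsHodge`);
* **`not_isNondegenerateFamily_of_prime_of_finrank_inf_eq_two`** — if `d = 2` then `M = L₀ ∩ L₁` is an IMAGINARY
  quadratic field inside both (`exists_conj_ne_of_finrank_inf_eq_two`: were `M` real, complex conjugation on `L₁` would lie
  in `Gal(L₁/M)`, of odd order `p`), the relative degrees `[K_i : M] = p` are odd, and EVERY family of CM types of the `K_i`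
  is DEGENERATE (`SharedImaginaryQuadraticDegenerate`), with no partial conjugations;
* **`isNondegenerateFamily_iff_of_prime`**-style packaging is left to the Summits side; here:
  `forall_exists_partialConj_pair_or_not_isNondegenerateFamily_of_prime` — the dichotomy in one statement.

Everything is proved; no definition, no named fact, no `sorry`.

## References

* [Lang2002] S. Lang, *Algebra*, 3rd ed., GTM 211, VI §1 Thm. 1.1, Cor. 1.4 (Galois correspondence, orders).
* [Gordon1999HodgeAVSurvey] B. B. Gordon, *A survey of the Hodge conjecture for abelian varieties*, §3 Theorem (proof),
  7.5–7.7.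
* [Shimura1998] G. Shimura, *Abelian Varieties with Complex Multiplication and Modular Functions*, §18.1–18.2.
-/

set_option autoImplicit false

noncomputable section

open scoped BigOperators
open NumberField NumberField.ComplexEmbedding Module IntermediateField

namespace Literature.NumberTheory.ComplexMultiplication

open Literature.AlgebraicGeometry.Motives (CMType)
open Literature.AlgebraicGeometry.Pohlmann1968

/-! ### Quadratic fields moved by conjugation are totally complex -/

section Quadratic

variable {k : Type} [Field k] [NumberField k]

/-- A quadratic number field with ONE non-real complex embedding `ι₀` has exactly the embeddings `ι₀`, `ῑ₀`.
[cite: Shimura1998, §18.1] -/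
private theorem eq_or_eq_conjugate_of_conjugate_ne (hk : finrank ℚ k = 2) (ι₀ : k →+* ℂ) (hι : conjugate ι₀ ≠ ι₀)
    (t : k →+* ℂ) : t = ι₀ ∨ t = conjugate ι₀ := by
  classical
  by_contra h
  push Not at h
  have hle : ({ι₀, conjugate ι₀, t} : Finset (k →+* ℂ)).card ≤ 2 := by
    rw [← hk, ← Embeddings.card k ℂ]
    exact Finset.card_le_univ _
  have h3 : ({ι₀, conjugate ι₀, t} : Finset (k →+* ℂ)).card = 3 := by
    rw [Finset.card_insert_of_notMem, Finset.card_pair fun h' => h.2 h'.symm]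
    simp only [Finset.mem_insert, Finset.mem_singleton, not_or]
    exact ⟨hι.symm, fun h' => h.1 h'.symm⟩
  omega

/-- **A quadratic number field with a non-real embedding is totally complex** (imaginary quadratic): both of its
embeddings `ι₀`, `ῑ₀` are non-real. [cite: Shimura1998, §18.1] -/
theorem isTotallyComplex_of_finrank_eq_two_of_conjugate_ne (hk : finrank ℚ k = 2) (ι₀ : k →+* ℂ)
    (hι : conjugate ι₀ ≠ ι₀) : IsTotallyComplex k := by
  refine ⟨fun v => InfinitePlace.not_isReal_iff_isComplex.1 fun hv => ?_⟩
  have hr := InfinitePlace.isReal_iff.1 hv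
  rw [ComplexEmbedding.isReal_iff] at hr
  rcases eq_or_eq_conjugate_of_conjugate_ne hk ι₀ hι v.embedding with h | h
  · exact hι (by rwa [h] at hr)
  · rw [h, ComplexEmbedding.involutive_conjugate k ι₀] at hr
    exact hι hr.symm

end Quadratic

/-! ### The intersection of two Galois CM fields of degree `2p` -/

section Prime

variable {I : Type} {K : I → Type} [∀ i, Field (K i)] [∀ i, NumberField (K i)] [∀ i, IsCMField (K i)]

/-- A subfield of a finite extension (inside `ℂ`) is finite. [folklore] -/
private theorem finiteDimensional_of_le₄ {E E' : IntermediateField ℚ ℂ} [FiniteDimensional ℚ E] (h : E' ≤ E) :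
    FiniteDimensional ℚ E' :=
  FiniteDimensional.of_injective (IntermediateField.inclusion h).toLinearMap (IntermediateField.inclusion_injective h)

/-- An automorphism of `ℂ` fixes `ℚ`. [folklore] -/
private theorem ringEquiv_apply_algebraMap₄ (g : ℂ ≃+* ℂ) (q : ℚ) : g (algebraMap ℚ ℂ q) = algebraMap ℚ ℂ q := by
  rw [eq_ratCast]
  exact map_ratCast g q

/-- The image in `ℂ` of a CM field is moved by complex conjugation. [folklore] -/
private theorem exists_mem_normalClosure_conj_ne₄ (i : I) : ∃ x ∈ normalClosure ℚ (K i) ℂ, starRingEnd ℂ x ≠ x := by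
  obtain ⟨t⟩ : Nonempty (K i →+* ℂ) := inferInstance
  have ht : ¬ComplexEmbedding.IsReal t := IsTotallyComplex.complexEmbedding_not_isReal t
  rw [ComplexEmbedding.isReal_iff] at ht
  have ht' : ¬∀ y : K i, starRingEnd ℂ (t y) = t y := fun h' =>
    ht (RingHom.ext fun y => by rw [ComplexEmbedding.conjugate_coe_eq, h' y])
  push Not at ht'
  obtain ⟨y, hy⟩ := ht'
  exact ⟨t y, apply_mem_normalClosure i t y, hy⟩

omit [∀ i, IsCMField (K i)] in
/-- **`[L₀ ∩ L₁ : ℚ] ∈ {1, 2, p}`** for two Galois number fields of degree `2p` (`p` prime) with different Galois closures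
`L₀ ≠ L₁` in `ℂ`: the degree divides `2p` and is not `2p`. [cite: Lang2002, VI §1 Cor. 1.4] -/
theorem finrank_inf_mem_of_prime {p : ℕ} (hp : p.Prime) {i₀ i₁ : I} [IsGalois ℚ (K i₀)] [IsGalois ℚ (K i₁)]
    (h₀ : finrank ℚ (K i₀) = 2 * p) (h₁ : finrank ℚ (K i₁) = 2 * p)
    (hne : normalClosure ℚ (K i₀) ℂ ≠ normalClosure ℚ (K i₁) ℂ) :
    finrank ℚ ↥(normalClosure ℚ (K i₀) ℂ ⊓ normalClosure ℚ (K i₁) ℂ) = 1 ∨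
      finrank ℚ ↥(normalClosure ℚ (K i₀) ℂ ⊓ normalClosure ℚ (K i₁) ℂ) = 2 ∨
        finrank ℚ ↥(normalClosure ℚ (K i₀) ℂ ⊓ normalClosure ℚ (K i₁) ℂ) = p := by
  haveI : FiniteDimensional ℚ ↥(normalClosure ℚ (K i₀) ℂ ⊓ normalClosure ℚ (K i₁) ℂ) :=
    finiteDimensional_of_le₄ inf_le_left
  have hL₀ : finrank ℚ (normalClosure ℚ (K i₀) ℂ) = 2 * p := (finrank_normalClosure_of_normal (K := K i₀)).trans h₀
  have hL₁ : finrank ℚ (normalClosure ℚ (K i₁) ℂ) = 2 * p := (finrank_normalClosure_of_normal (K := K i₁)).trans h₁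
  have hdvd : finrank ℚ ↥(normalClosure ℚ (K i₀) ℂ ⊓ normalClosure ℚ (K i₁) ℂ) ∣ 2 * p :=
    hL₀ ▸ IntermediateField.finrank_dvd_of_le_right (inf_le_left : _ ≤ normalClosure ℚ (K i₀) ℂ)
  have hne' : finrank ℚ ↥(normalClosure ℚ (K i₀) ℂ ⊓ normalClosure ℚ (K i₁) ℂ) ≠ 2 * p := by
    intro h
    apply hne
    have e₀ : normalClosure ℚ (K i₀) ℂ ⊓ normalClosure ℚ (K i₁) ℂ = normalClosure ℚ (K i₀) ℂ :=
      IntermediateField.eq_of_le_of_finrank_eq inf_le_left (by rw [h, hL₀])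
    have e₁ : normalClosure ℚ (K i₀) ℂ ⊓ normalClosure ℚ (K i₁) ℂ = normalClosure ℚ (K i₁) ℂ :=
      IntermediateField.eq_of_le_of_finrank_eq inf_le_right (by rw [h, hL₁])
    exact e₀.symm.trans e₁
  obtain ⟨d₁, d₂, hd₁, hd₂, hd⟩ := Nat.dvd_mul.1 hdvd
  rcases (Nat.dvd_prime Nat.prime_two).1 hd₁ with rfl | rfl <;>
    rcases (Nat.dvd_prime hp).1 hd₂ with rfl | rfl
  · left; omega
  · right; right; omega
  · right; left; omega
  · exact absurd (by omega) hne'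

omit [∀ i, IsCMField (K i)] in
/-- **Case `[L₀ ∩ L₁ : ℚ] ≠ 2`: partial conjugations.**  For `p` an ODD prime the remaining degrees `1`, `p` are odd,
so `L₀ ∩ L₁` is totally real and both slots carry partial conjugations. [cite: Gordon1999HodgeAVSurvey, §3 Theorem (proof)] -/
theorem forall_exists_partialConj_pair_of_prime_of_finrank_inf_ne_two [Finite I] {p : ℕ} (hp : p.Prime)
    (hp2 : p ≠ 2) {i₀ i₁ : I} (h01 : i₀ ≠ i₁) (hI : ∀ j, j = i₀ ∨ j = i₁) [IsGalois ℚ (K i₀)] [IsGalois ℚ (K i₁)]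
    (h₀ : finrank ℚ (K i₀) = 2 * p) (h₁ : finrank ℚ (K i₁) = 2 * p)
    (hne : normalClosure ℚ (K i₀) ℂ ≠ normalClosure ℚ (K i₁) ℂ)
    (h2 : finrank ℚ ↥(normalClosure ℚ (K i₀) ℂ ⊓ normalClosure ℚ (K i₁) ℂ) ≠ 2) :
    ∀ i : I, ∃ σ : ℂ ≃+* ℂ, (∀ s : K i →+* ℂ, σ • s = (starRingAut : ℂ ≃+* ℂ) • s) ∧
      ∀ j, j ≠ i → ∀ s : K j →+* ℂ, σ • s = s := by
  refine forall_exists_partialConj_pair_of_odd_finrank h01 hI ?_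
  rcases finrank_inf_mem_of_prime hp h₀ h₁ hne with h | h | h
  · rw [h]; exact odd_one
  · exact absurd h h2
  · rw [h]; exact hp.odd_of_ne_two hp2

/-- **Case `[L₀ ∩ L₁ : ℚ] = 2`: the intersection is moved by complex conjugation.**  If `M = L₀ ∩ L₁` is quadratic then
some `x ∈ M` has `x̄ ≠ x` (`M` is IMAGINARY quadratic): otherwise conjugation restricted to `L₁` — an element of order `2`,
as `L₁` is a CM field — would lie in `Gal(L₁/M)`, a group of odd order `[L₁ : M] = p`. [cite: Lang2002, VI §1 Thm. 1.1 and Cor. 1.4] -/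
theorem exists_conj_ne_of_finrank_inf_eq_two {p : ℕ} (hp : p.Prime) (hp2 : p ≠ 2) {i₀ i₁ : I} [IsGalois ℚ (K i₁)]
    (h₁ : finrank ℚ (K i₁) = 2 * p)
    (h2 : finrank ℚ ↥(normalClosure ℚ (K i₀) ℂ ⊓ normalClosure ℚ (K i₁) ℂ) = 2) :
    ∃ x ∈ normalClosure ℚ (K i₀) ℂ ⊓ normalClosure ℚ (K i₁) ℂ, starRingEnd ℂ x ≠ x := by
  by_contra hall
  push Not at hall
  -- pin the instances
  haveI hN : @Normal ℚ ↥(normalClosure ℚ (K i₁) ℂ) _ _ (IntermediateField.algebra' _) := normal_normalClosure_complex i₁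
  letI iL : Algebra ℚ ↥(normalClosure ℚ (K i₁) ℂ) := IntermediateField.algebra' _
  have hML : normalClosure ℚ (K i₀) ℂ ⊓ normalClosure ℚ (K i₁) ℂ ≤ normalClosure ℚ (K i₁) ℂ := inf_le_right
  letI iM' : Algebra ℚ ↥(IntermediateField.restrict hML) := IntermediateField.algebra' _
  haveI : Algebra.IsSeparable ℚ ↥(normalClosure ℚ (K i₁) ℂ) := Algebra.IsAlgebraic.isSeparable_of_perfectField
  haveI : IsGalois ℚ ↥(normalClosure ℚ (K i₁) ℂ) := ⟨⟩
  have hL₁ : finrank ℚ (normalClosure ℚ (K i₁) ℂ) = 2 * p := (finrank_normalClosure_of_normal (K := K i₁)).trans h₁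
  -- complex conjugation restricted to `L₁`
  let cQ : ℂ ≃ₐ[ℚ] ℂ := AlgEquiv.ofRingEquiv (f := (starRingAut : ℂ ≃+* ℂ)) (ringEquiv_apply_algebraMap₄ _)
  let c : (↥(normalClosure ℚ (K i₁) ℂ)) ≃ₐ[ℚ] ↥(normalClosure ℚ (K i₁) ℂ) := cQ.restrictNormal _
  have hc : ∀ y : ↥(normalClosure ℚ (K i₁) ℂ), ((c y : ↥(normalClosure ℚ (K i₁) ℂ)) : ℂ) = starRingEnd ℂ y :=
    fun y => AlgEquiv.restrictNormal_commutes cQ _ y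
  -- it fixes `M' = M` (viewed inside `L₁`) pointwise
  have hmem : c ∈ (IntermediateField.restrict hML).fixingSubgroup := by
    rw [IntermediateField.mem_fixingSubgroup_iff]
    intro y hy
    exact Subtype.ext ((hc y).trans (hall y ((IntermediateField.mem_restrict hML y).1 hy)))
  -- `|Gal(L₁/M')| = [L₁ : M'] = p`
  have hfin : finrank ℚ ↥(IntermediateField.restrict hML) = 2 := by
    rw [← h2]
    exact (IntermediateField.restrict_algEquiv hML).toLinearEquiv.finrank_eq.symm
  have hcard : Nat.card (IntermediateField.restrict hML).fixingSubgroup = p := by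
    rw [IsGalois.card_fixingSubgroup_eq_finrank]
    have htower := Module.finrank_mul_finrank ℚ ↥(IntermediateField.restrict hML) ↥(normalClosure ℚ (K i₁) ℂ)
    rw [hfin, hL₁] at htower
    omega
  -- `c` has order dividing `2` and `p`, hence `c = 1`
  have hc2 : c ^ 2 = 1 := by
    rw [pow_two]
    refine AlgEquiv.ext fun y => Subtype.ext ?_
    rw [AlgEquiv.mul_apply, AlgEquiv.one_apply, hc, hc]
    exact Complex.conj_conj _
  have hdvd : orderOf c ∣ p := by
    have := orderOf_dvd_natCard (⟨c, hmem⟩ : (IntermediateField.restrict hML).fixingSubgroup)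
    rwa [Subgroup.orderOf_mk, hcard] at this
  have h1 : orderOf c = 1 :=
    Nat.eq_one_of_dvd_coprimes (Nat.coprime_two_left.2 (hp.odd_of_ne_two hp2)) (orderOf_dvd_of_pow_eq_one hc2) hdvd
  have hc1 : c = 1 := orderOf_eq_one_iff.1 h1
  -- but `L₁` is moved by conjugation
  obtain ⟨x, hx, hxne⟩ := exists_mem_normalClosure_conj_ne₄ (K := K) i₁
  have := hc ⟨x, hx⟩
  rw [hc1, AlgEquiv.one_apply] at this
  exact hxne this.symm

/-- **Case `[L₀ ∩ L₁ : ℚ] = 2`: every family of CM types is DEGENERATE.**  `M = L₀ ∩ L₁` is an imaginary quadratic field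
inside both `K_{i₀}` and `K_{i₁}` with odd relative degree `p`, so both signature defects on `M` are non-zero and
`SharedImaginaryQuadraticDegenerate` applies: `¬ IsNondegenerateFamily Φ` for every `Φ`, whatever the other slots.
[cite: Gordon1999HodgeAVSurvey, 7.5–7.7] -/
theorem not_isNondegenerateFamily_of_prime_of_finrank_inf_eq_two [Fintype I] {p : ℕ} (hp : p.Prime) (hp2 : p ≠ 2)
    {i₀ i₁ : I} (h01 : i₀ ≠ i₁) [IsGalois ℚ (K i₀)] [IsGalois ℚ (K i₁)] (h₀ : finrank ℚ (K i₀) = 2 * p)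
    (h₁ : finrank ℚ (K i₁) = 2 * p) (h2 : finrank ℚ ↥(normalClosure ℚ (K i₀) ℂ ⊓ normalClosure ℚ (K i₁) ℂ) = 2)
    (Φ : ∀ i, CMType (K i)) : ¬ CMAlgebra.IsNondegenerateFamily Φ := by
  haveI : Nonempty I := ⟨i₀⟩
  -- the shared quadratic field `M ≤ ℂ`, as a number field with its inclusion `ι₀`
  set M : IntermediateField ℚ ℂ := normalClosure ℚ (K i₀) ℂ ⊓ normalClosure ℚ (K i₁) ℂ with hMdef
  haveI : FiniteDimensional ℚ ↥M := finiteDimensional_of_le₄ inf_le_left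
  haveI : NumberField ↥M := NumberField.mk
  let ι₀ : ↥M →+* ℂ := (algebraMap ↥M ℂ)
  obtain ⟨x, hxM, hxne⟩ := exists_conj_ne_of_finrank_inf_eq_two (K := K) (i₀ := i₀) hp hp2 h₁ h2
  have hι : conjugate ι₀ ≠ ι₀ := by
    intro h
    have := RingHom.congr_fun h ⟨x, hxM⟩
    rw [ComplexEmbedding.conjugate_coe_eq] at this
    exact hxne this
  haveI : IsTotallyComplex ↥M := isTotallyComplex_of_finrank_eq_two_of_conjugate_ne h2 ι₀ hι
  -- the embeddings `M → K_{i₀}`, `M → K_{i₁}` (through `L_i = s_i(K_i)`)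
  obtain ⟨s₀⟩ : Nonempty (K i₀ →+* ℂ) := inferInstance
  obtain ⟨s₁⟩ : Nonempty (K i₁ →+* ℂ) := inferInstance
  have hM₀ : M ≤ s₀.toRatAlgHom.fieldRange := by
    rw [← normalClosure_eq_fieldRange_of_normal s₀.toRatAlgHom]; exact inf_le_left
  have hM₁ : M ≤ s₁.toRatAlgHom.fieldRange := by
    rw [← normalClosure_eq_fieldRange_of_normal s₁.toRatAlgHom]; exact inf_le_right
  have hM₀' : ∀ x : ℂ, x ∈ M → x ∈ s₀.toRatAlgHom.range := fun x hx =>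
    (AlgHom.mem_range _).2 (AlgHom.mem_fieldRange.1 (hM₀ hx))
  have hM₁' : ∀ x : ℂ, x ∈ M → x ∈ s₁.toRatAlgHom.range := fun x hx =>
    (AlgHom.mem_range _).2 (AlgHom.mem_fieldRange.1 (hM₁ hx))
  let incl₀ : ↥M →+* ↥s₀.toRatAlgHom.range :=
    { toFun := fun x => ⟨x.1, hM₀' x.1 x.2⟩
      map_one' := rfl
      map_mul' := fun _ _ => rfl
      map_zero' := rfl
      map_add' := fun _ _ => rfl }
  let incl₁ : ↥M →+* ↥s₁.toRatAlgHom.range :=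
    { toFun := fun x => ⟨x.1, hM₁' x.1 x.2⟩
      map_one' := rfl
      map_mul' := fun _ _ => rfl
      map_zero' := rfl
      map_add' := fun _ _ => rfl }
  let j₀ : ↥M →+* K i₀ := (AlgEquiv.ofInjectiveField s₀.toRatAlgHom).symm.toRingEquiv.toRingHom.comp incl₀
  let j₁ : ↥M →+* K i₁ := (AlgEquiv.ofInjectiveField s₁.toRatAlgHom).symm.toRingEquiv.toRingHom.comp incl₁
  refine not_isNondegenerateFamily_of_shared_quadratic_of_odd (k := ↥M) h2 ι₀ h01 j₀ j₁ ?_ ?_ Φ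
  · rw [h₀, Nat.mul_div_cancel_left _ two_pos]; exact hp.odd_of_ne_two hp2
  · rw [h₁, Nat.mul_div_cancel_left _ two_pos]; exact hp.odd_of_ne_two hp2

/-- **The dichotomy for two Galois CM fields of degree `2p`** (`p` odd prime, different Galois closures in `ℂ`): either
both slots carry partial conjugations (`[L₀ ∩ L₁ : ℚ] ∈ {1, p}`: additive rank, and on abelian varieties `B• = D•` for
nondegenerate types), or every family of CM types of the `K_i` is degenerate (`[L₀ ∩ L₁ : ℚ] = 2`: a shared imaginary
quadratic field). [cite: Gordon1999HodgeAVSurvey, §3 Theorem and 7.5–7.7] -/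
theorem forall_exists_partialConj_pair_or_not_isNondegenerateFamily_of_prime [Fintype I] {p : ℕ} (hp : p.Prime)
    (hp2 : p ≠ 2) {i₀ i₁ : I} (h01 : i₀ ≠ i₁) (hI : ∀ j, j = i₀ ∨ j = i₁) [IsGalois ℚ (K i₀)] [IsGalois ℚ (K i₁)]
    (h₀ : finrank ℚ (K i₀) = 2 * p) (h₁ : finrank ℚ (K i₁) = 2 * p)
    (hne : normalClosure ℚ (K i₀) ℂ ≠ normalClosure ℚ (K i₁) ℂ) :
    (∀ i : I, ∃ σ : ℂ ≃+* ℂ, (∀ s : K i →+* ℂ, σ • s = (starRingAut : ℂ ≃+* ℂ) • s) ∧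
        ∀ j, j ≠ i → ∀ s : K j →+* ℂ, σ • s = s) ∨
      ∀ Φ : ∀ i, CMType (K i), ¬ CMAlgebra.IsNondegenerateFamily Φ := by
  by_cases h2 : finrank ℚ ↥(normalClosure ℚ (K i₀) ℂ ⊓ normalClosure ℚ (K i₁) ℂ) = 2
  · exact Or.inr fun Φ => not_isNondegenerateFamily_of_prime_of_finrank_inf_eq_two hp hp2 h01 h₀ h₁ h2 Φ
  · exact Or.inl (forall_exists_partialConj_pair_of_prime_of_finrank_inf_ne_two hp hp2 h01 hI h₀ h₁ hne h2)

/-- **The two cases are exclusive**: partial conjugations and a degenerate family cannot coexist when the members are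
nondegenerate — under partial conjugations the family is nondegenerate iff every member is.
[cite: Gordon1999HodgeAVSurvey, §3 Theorem and 7.5] -/
theorem isNondegenerateFamily_of_forall_exists_partialConj [Fintype I] [Nonempty I]
    (hconj : ∀ i : I, ∃ σ : ℂ ≃+* ℂ, (∀ s : K i →+* ℂ, σ • s = (starRingAut : ℂ ≃+* ℂ) • s) ∧
      ∀ j, j ≠ i → ∀ s : K j →+* ℂ, σ • s = s)
    (Φ : ∀ i, CMType (K i)) (hΦ : ∀ i, IsNondegenerate (Φ i)) : CMAlgebra.IsNondegenerateFamily Φ := by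
  have key := typeRank_sigmaType_eq_iff_forall_of_partialConj (G := ℂ ≃+* ℂ) (Φ := fun i => (Φ i).1)
    (fun i => isCMTypeWith_conj (Φ i)) hconj
  have hcard : Fintype.card ((i : I) × (K i →+* ℂ)) = ∑ i, Module.finrank ℚ (K i) := by
    rw [Fintype.card_sigma]
    exact Finset.sum_congr rfl fun i _ => Embeddings.card (K i) ℂ
  rw [hcard] at key
  simp only [Embeddings.card] at key
  exact key.2 hΦ

end Prime

end Literature.NumberTheory.ComplexMultiplication

end
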